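import Literature.AlgebraicGeometry.HodgeTheory.BettiHodgeConjectureProductsOffMiddleAlgebraicFactor
import Literature.AlgebraicGeometry.HodgeTheory.SupportedClassesGysinSpan
import Literature.AlgebraicGeometry.HodgeTheory.LefschetzOneOneHolds
import Literature.AlgebraicGeometry.HodgeTheory.HodgeRiemannPolarizabilityProofs
import Literature.AlgebraicGeometry.HodgeTheory.AlgebraicClassesExteriorProduct
import Literature.AlgebraicGeometry.HodgeTheory.SupportedClassesOfChowZeroSupportedAboveDim
import Literature.AlgebraicGeometry.HodgeTheory.CubicFourfoldHodgeConjectureChowZero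
import Literature.AlgebraicGeometry.HodgeTheory.BettiHodgeGroupMinusIdentityParity
import Literature.AlgebraicGeometry.HodgeTheory.ComplexConjugationHolds
import Literature.AlgebraicGeometry.Motives.ChowZeroSupportedOnHyperplaneSectionOfDegreeLE
import Literature.AlgebraicGeometry.Motives.HodgeTensorFactsHolds
import HarnessLib

/-!
# `HC(Y × Y')` for two smooth hypersurfaces of odd dimension whose middle cohomologies are supported in
# complementary codimension — unconditionally; in particular for ANY two smooth hypersurface threefolds of
# degree `≤ 4` in `ℙ⁴_ℂ` (cubic × cubic, cubic × quartic, quartic × quartic, …)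
# (Bloch–Srinivas 1983 Thm. 1; Voisin II Thm. 10.17 / Prop. 10.26 / Thm. 10.31; Voisin 2013 Lemma 2.1; Voisin I §11.3.3)

Family `hodge`, layer `Literature/AlgebraicGeometry/HodgeTheory`; written for the cell `hodge-nonav`
(planner memo ROUTE-P3v20 «SPLIT HYPERSURFACES», sketch `SplitSketch.lean` r5: LEMMA AB at
`(m; r, s) = (4; 3, 3)` = `QuarticSuspensionPairsHCN`, the one proving target left in the kernel form
`splitQuarticSixfoldHCN_of_facts` of THEOREM T8 «HC for every smooth split quartic sixfold
`{f(x₀..x₃) + g(y₀..y₃) = 0}` modulo the Stage-4 leaf `HC_K3Pairs`»). THEOREMS ONLY: no definition, no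
named fact, no instance (D-0026 net debt `0`); every input is a theorem of the tree.

THE ARGUMENT (as printed, assembled). Let `Y ⊂ ℙ^{m+1}`, `Y' ⊂ ℙ^{n+1}` be smooth complex hypersurfaces
of ODD dimensions `m`, `n`. Off the middle degree their cohomology is algebraic and their odd Betti
numbers vanish (Voisin II Cor. 1.24–1.25), so by the Künneth decomposition of Hodge classes (Voisin I
§11.3.3 Thm. 11.38–11.40, Lemma 11.41, p. 287) `HC(Y × Y')` reduces to the algebraicity of the Hodge
classes of the ONE Künneth piece `Hᵐ(Y) ⊗ Hⁿ(Y') ⊂ H^{m+n}(Y × Y')` — this reduction is the tree's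
`BettiUniverse.hodgeConjectureFor_tensor_of_offMiddle_algebraic` read on hypersurfaces exactly as in
`Motives.IsSmoothHypersurface.hodgeConjectureFor_tensor_hypersurface_of_odd_of_odd`
(`BettiHodgeConjectureProductsOffMiddleAlgebraicFactor`). Now suppose the middle cohomologies are
SUPPORTED in codimensions `r`, `s` with `2(r + s + 1) = m + n`, i.e. `Hᵐ(Y(ℂ); ℂ) = Nʳ Hᵐ` and
`Hⁿ(Y'(ℂ); ℂ) = Nˢ Hⁿ` in Grothendieck's filtration by codimension of support (`supportedClasses`;
Grothendieck, Topology 8 (1969) §1). Exterior products of supported classes are supported on the product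
of the supports (`cupProduct_map_fst_map_snd_mem_supportedClasses`, file `AlgebraicClassesExteriorProduct`:
Voisin II proof of Prop. 9.20 read on supports, with Hartshorne III.9.5 for the codimension count), so the
whole piece `Hᵐ(Y) ⊗ Hⁿ(Y')` lies in `N^{r+s} H^{2(r+s+1)}(Y × Y')`; and **a rational Hodge class of degree
`2(p+1)` supported in codimension `≥ p` is algebraic** — Voisin 2013, proof of Lemma 2.1 (Deligne, Hodge III
Cor. 8.2.8: the class is a sum of Gysin images from desingularisations of the components of the support;
Voisin 2025 Cor. 2.12: being a Hodge class it lifts to Hodge classes of degree `2` there, by the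
semisimplicity of polarisable Hodge structures; Lefschetz `(1,1)`; push forward), which the tree PROVES as
`mem_algebraicClasses_of_mem_supportedClasses_of_isOfHodgeType` (`SupportedHodgeClassesAlgebraic`) from
five named facts that are by now ALL theorems of the tree:
`Deligne1974_ker_restrictCompl_eq_iSup_range_complexGysin_holds`, `Voisin2025_hodgeClass_lift_complexGysin_holds`,
`Resolution.Hironaka1964_projective_holds`, `gysinMap_restrictCompl_eq_zero_of_field ℂ`,
`lefschetzOneOne_rational_holds` (and `OrientationFamily.hasPoincareDuality`). Hence `HC(Y × Y')`.

THE THREEFOLD CASE. For a smooth hypersurface THREEFOLD `Y ⊂ ℙ⁴_ℂ` of degree `e ≤ 4`, `CH₀(Y)` is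
supported on a hyperplane section, point by point — lines through every point for `e ≤ 3`
(`hasChowZeroSupportedInDimLE_of_isSmoothHypersurface`, Esnault–Levine–Viehweg Lemma 4.2 a)), Roitman's
STRONG LINES for `2 ≤ e ≤ 4 = 3 + 1` (`Motives.Hypersurface.exists_forall_isRationallyEquivalent_primeCycle_of_degree_le`,
Roitman 1980 / Hirschowitz–Iyer 2010 §1.3) — so `CH₀(Y)` is supported on a surface
(`HasChowZeroSupportedInDimLE Y 2`), and by BLOCH–SRINIVAS (Amer. J. Math. 105 (1983) Thm. 1 (ii); Voisin II
Thm. 10.17 / Thm. 10.31), PROVED on the tree's carriers as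
`supportedClasses_eq_top_of_hasChowZeroSupportedInDimLE_of_lt`, `H³(Y(ℂ); ℂ) = N¹ H³` («`H³` is supported on
a divisor», equivalently parametrised by algebraic cycles of a surface through the intermediate Jacobian;
Murre, LNM 1594 §5.8.1, for Fano threefolds). With `m = n = 3`, `r = s = 1`, `2(1 + 1 + 1) = 6`: **`HC(Y × Y')`
for any two smooth hypersurface threefolds of degrees `1 ≤ e, e' ≤ 4`** — unconditionally (the standing
instance hypothesis `[HodgeTensorFacts]` and the real Hodge model are discharged by `hodgeTensorFacts_holds`,
`exists_isReal_hodgeModel_holds`).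

WHAT IS PROVED.
* §1 `BettiUniverse.ofRatClass_crossMap_mem_supportedClasses_of_eq_top` — if `Hⁱ(Y(ℂ); ℂ) = Nʳ Hⁱ` and
  `Hʲ(Z(ℂ); ℂ) = Nˢ Hʲ` then the complexification of every `crossMap t`, `t ∈ Hⁱ(Y;ℚ) ⊗ Hʲ(Z;ℚ)`, lies in
  `N^{r+s} H^{i+j}((Y ⊗ Z)(ℂ); ℂ)` (no Hodge theory).
* §2 `BettiUniverse.ofRatClass_crossMap_mem_algebraicClasses_of_supportedClasses_eq_top` — under the same
  hypotheses with `i + j = 2(p+1)`, `p ≤ r + s`, every Hodge class `t` of the Künneth summand `Hⁱ(Y) ⊗ Hʲ(Z)`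
  has `crossMap t` ALGEBRAIC (Voisin 2013 Lemma 2.1 on the product).
* §3 `Motives.IsSmoothHypersurface.hodgeConjectureFor_tensor_hypersurface_of_odd_of_odd_of_supportedClasses_eq_top`
  — `HC(Y × Y')` for smooth hypersurfaces of odd dimensions `m`, `n` with `Hᵐ(Y) = Nʳ Hᵐ`, `Hⁿ(Y') = Nˢ Hⁿ`,
  `m + n ≤ 2(r + s + 1)` (model-free: `hodgeConjectureFor_…_eq_top'`).
* §4 `Motives.IsSmoothHypersurface.hasChowZeroSupportedInDimLE_of_degree_le_succ` (`1 ≤ e ≤ n + 1` ⇒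
  `CH₀` on a hyperplane section), `Motives.IsSmoothHypersurface.supportedClasses_middle_one_eq_top_of_degree_le_succ`
  (`N¹ Hⁿ(Y) = Hⁿ(Y)` for `n ≥ 1`, `1 ≤ e ≤ n + 1`), in particular
  `…supportedClasses_three_one_eq_top_of_degree_le_four` for threefolds.
* §5 **`Motives.IsSmoothHypersurface.hodgeConjectureFor_tensor_threefolds_of_degree_le_four`** — `HC(Y × Y')`
  for smooth hypersurface threefolds `Y, Y' ⊂ ℙ⁴_ℂ` of degrees `1 ≤ e, e' ≤ 4`; **`…_quartic_threefolds`**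
  (`e = e' = 4`, LEMMA AB (4;3,3) of the cell's memo on the tree's carrier `IsSmoothHypersurface 3 4`).

DEVIATIONS / SCOPE. Nothing is claimed for quintic threefolds (`h^{3,0} ≠ 0`: `H³` is not supported on a
divisor) nor for cubic fivefolds (LEMMA AB (3;5,5) would need `N² H⁵ = H⁵`, i.e. `CH₁ ⊗ ℚ = ℚ`, which the tree
holds only as the named fact `Motives.EsnaultLevineViehweg1997_chowGroup_rank_le_one`). The statements are not
verbatim in print as theorems about products; they are the printed three-step argument (Bloch–Srinivas
support of `H³`, Künneth, Lefschetz `(1,1)` after lifting along Gysin maps) assembled on the tree's carriers —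
nearest prints: Conte–Murre 1978 (uniruled fourfolds), Voisin II §10.2.3 / Thm. 10.31, Voisin 2013 Lemma 2.1.

## References
* [BlochSrinivas1983] S. Bloch, V. Srinivas, *Remarks on correspondences and algebraic cycles*, Amer. J. Math.
  105 (1983) 1235–1253 — Thm. 1.
* [VoisinHodgeII2003] C. Voisin, *Hodge Theory and Complex Algebraic Geometry II* (CUP 2003) — §1.2.3
  Cor. 1.24–1.25; §9.2.4 proof of Prop. 9.20; §10.2.2 Thm. 10.17; §10.2.3 Prop. 10.26 and the remark following
  it; §10.3.1 Thm. 10.29, Thm. 10.31.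
* [VoisinHodgeI2002] C. Voisin, *Hodge Theory and Complex Algebraic Geometry I* (CUP 2002) — §11.3.3
  Thm. 11.38, Thm. 11.40, Lemma 11.41, p. 287; §11.3.1 Thm. 11.30.
* [Voisin2013GHCBloch] C. Voisin, *The generalized Hodge and Bloch conjectures are equivalent for general
  complete intersections*, Ann. Sci. ÉNS 46 (2013) — Lemma 2.1 (proof).
* [Voisin2025] C. Voisin, *Hodge and generalized Hodge conjectures, coniveau and algebraic cycles*, J. Open
  Math. Probl. 1 (2025) — Cor. 2.12, Thm. 4.4 / Cor. 4.5, §5.2 Thm. 5.6 / Cor. 5.7.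
* [GrothendieckTopology1969] A. Grothendieck, *Hodge's general conjecture is false for trivial reasons*,
  Topology 8 (1969) — §1 and p. 300.
* [DeligneHodgeIII1974] P. Deligne, *Théorie de Hodge III* — Cor. 8.2.8.
* [HirschowitzIyer2010] A. Hirschowitz, J. N. N. Iyer, Contemp. Math. 522 (2010) — §1.3, proof of Prop. 6.2 (i).
* [Roitman1980] A. A. Roitman, Mat. Zametki 28 (1980) 85–90.
* [EsnaultLevineViehweg1997] H. Esnault, M. Levine, E. Viehweg, Duke Math. J. 87 (1997) — Lemma 4.2 a).
* [MurreTorino1994] J. P. Murre, LNM 1594 (1994) — §5.8.1.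

## Provenance
Cell `hodge-nonav` (summit `HodgeConjecture`, ladder FRONTIER rung F-H1), seat `littype-FH1-2` (literature-prover,
generation 17), for P3's ROUTE-P3v20 LEMMA AB (4;3,3).
-/

noncomputable section

open scoped TensorProduct
open CategoryTheory AlgebraicGeometry MonoidalCategory CartesianMonoidalCategory Module Finset
open Literature.AlgebraicTopology.SingularHomology
open Literature.Geometry.Kaehler

namespace Literature.AlgebraicGeometry.HodgeTheory

open Literature.AlgebraicGeometry.Motives
open Literature.AlgebraicGeometry.Motives.HodgeStructure
open Literature.Barriers.HodgeConjecture (HasChowZeroSupportedInDimLE)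

variable {m n d : ℕ} {Y Z : SchemeOver ℂ}

/-! ### §1 Cross products of supported classes are supported (no Hodge theory) -/

/-- **If `Hⁱ(Y(ℂ); ℂ) = Nʳ Hⁱ` and `Hʲ(Z(ℂ); ℂ) = Nˢ Hʲ`, the complexification of every rational cross-product
class `crossMap t`, `t ∈ Hⁱ(Y;ℚ) ⊗ Hʲ(Z;ℚ)`, lies in `N^{r+s} H^{i+j}((Y ⊗ Z)(ℂ); ℂ)`**: on pure tensors
`(fst^* y ∪ snd^* z) ⊗ 1 = fst^*(y ⊗ 1) ∪ snd^*(z ⊗ 1)` and exterior products of classes supported in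
codimensions `r`, `s` are supported in codimension `r + s` (`cupProduct_map_fst_map_snd_mem_supportedClasses`).
[cite: GrothendieckTopology1969, §1 and p. 300] [cite: VoisinHodgeII2003, §9.2.4 proof of Prop. 9.20] -/
theorem BettiUniverse.ofRatClass_crossMap_mem_supportedClasses_of_eq_top (hY : IsSmoothProjective m Y)
    (hZ : IsSmoothProjective n Z) {i j k r s : ℕ} (hk : i + j = k) (hYs : supportedClasses Y i r = ⊤)
    (hZs : supportedClasses Z j s = ⊤) (t : bettiCohomology Y i ⊗[ℚ] bettiCohomology Z j) :
    ofRatClass (ComplexPoints (Y ⊗ Z)) k (BettiUniverse.crossMap Y Z hk t) ∈ supportedClasses (Y ⊗ Z) k (r + s) := by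
  induction t using TensorProduct.induction_on with
  | zero => rw [map_zero, map_zero]; exact Submodule.zero_mem _
  | tmul y z =>
    rw [BettiUniverse.crossMap_tmul, BettiUniverse.ofRatClass_bettiCup, BettiUniverse.ofRatClass_pull,
      BettiUniverse.ofRatClass_pull]
    exact cupProduct_map_fst_map_snd_mem_supportedClasses hY hZ hk (by rw [hYs]; exact Submodule.mem_top)
      (by rw [hZs]; exact Submodule.mem_top)
  | add x y hx hy => rw [map_add, map_add]; exact Submodule.add_mem _ hx hy

/-! ### §2 Hodge classes of a Künneth piece supported in codimension `≥ p` and degree `2(p+1)` are algebraic -/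

section Hodge

variable [HodgeTensorFacts.{0, 0}]

/-- **Voisin 2013 Lemma 2.1 on a Künneth piece.** For smooth projective `Y`, `Z` with
`Hⁱ(Y(ℂ); ℂ) = Nʳ Hⁱ`, `Hʲ(Z(ℂ); ℂ) = Nˢ Hʲ`, `i + j = 2(p+1)` and `p ≤ r + s`, every Hodge class `t` of the
Künneth summand `Hⁱ(Y) ⊗ Hʲ(Z) ⊂ H^{2(p+1)}(Y ⊗ Z)` has `crossMap t` ALGEBRAIC: it is a rational class of type
`(p+1, p+1)` (`BettiUniverse.crossMap_mem_hodgeClasses`) supported in codimension `≥ r + s ≥ p` (§1), and such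
classes are algebraic by the tree's PROVED `mem_algebraicClasses_of_mem_supportedClasses_of_isOfHodgeType`
(Deligne Cor. 8.2.8 + lifting along Gysin surjections + Lefschetz `(1,1)`, all inputs `_holds`).
[cite: Voisin2013GHCBloch, Lemma 2.1 (proof)] [cite: Voisin2025, Cor. 2.12 and Thm. 4.4] [cite: DeligneHodgeIII1974, Cor. 8.2.8]
[cite: VoisinHodgeI2002, §11.3.3 Thm. 11.40, Lemma 11.41 and §11.3.1 Thm. 11.30] -/
theorem BettiUniverse.ofRatClass_crossMap_mem_algebraicClasses_of_supportedClasses_eq_top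
    (hHD : exists_isReal_hodgeModel) (hY : IsSmoothProjective m Y) (hZ : IsSmoothProjective n Z)
    (hYZ : IsSmoothProjective d (Y ⊗ Z)) {i j p r s : ℕ} (hk : i + j = 2 * (p + 1)) (hp : p ≤ r + s)
    (hYs : supportedClasses Y i r = ⊤) (hZs : supportedClasses Z j s = ⊤)
    {t : bettiCohomology Y i ⊗[ℚ] bettiCohomology Z j}
    (ht : t ∈ (BettiUniverse.kunnethSummand hHD hY hZ (2 * (p + 1)) ⟨(i, j), HasAntidiagonal.mem_antidiagonal.2 hk⟩).hodgeClasses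
      ((p + 1 : ℕ) : ℤ)) :
    ofRatClass (ComplexPoints (Y ⊗ Z)) (2 * (p + 1)) (BettiUniverse.crossMap Y Z hk t) ∈ algebraicClasses (Y ⊗ Z) (p + 1) := by
  -- the class is supported in codimension `≥ p`
  have hsupp : ofRatClass (ComplexPoints (Y ⊗ Z)) (2 * (p + 1)) (BettiUniverse.crossMap Y Z hk t) ∈
      supportedClasses (Y ⊗ Z) (2 * (p + 1)) p :=
    supportedClasses_mono (X := Y ⊗ Z) (2 * (p + 1)) hp
      (BettiUniverse.ofRatClass_crossMap_mem_supportedClasses_of_eq_top hY hZ hk hYs hZs t)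
  -- it is a rational Hodge class of type `(p+1, p+1)`
  have hhodge : BettiUniverse.crossMap Y Z hk t ∈ (BettiUniverse.hodge hHD hYZ (2 * (p + 1))).hodgeClasses ((p + 1 : ℕ) : ℤ) :=
    BettiUniverse.crossMap_mem_hodgeClasses hHD hodgePQ_independent_of_hodgeModel_holds hY hZ hYZ hk _ ht
  have htype : IsOfHodgeType d (Y ⊗ Z) (2 * (p + 1)) (p + 1) (p + 1)
      (ofRatClass (ComplexPoints (Y ⊗ Z)) (2 * (p + 1)) (BettiUniverse.crossMap Y Z hk t)) :=
    (BettiUniverse.mem_hodgeClasses_hodge_iff_isOfHodgeType hHD hYZ (p + 1) _).1 hhodge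
  -- Voisin 2013, Lemma 2.1 (all five named-fact inputs are theorems of the tree)
  exact mem_algebraicClasses_of_mem_supportedClasses_of_isOfHodgeType
    Deligne1974_ker_restrictCompl_eq_iSup_range_complexGysin_holds Voisin2025_hodgeClass_lift_complexGysin_holds
    (gysinMap_restrictCompl_eq_zero_of_field ℂ) Resolution.Hironaka1964_projective_holds lefschetzOneOne_rational_holds
    complexOrientationFamily complexOrientationFamily.hasPoincareDuality hYZ p hsupp (isRationalClass_ofRatClass _) htype

end Hodge

end Literature.AlgebraicGeometry.HodgeTheory

/-! ### §3 Products of two odd-dimensional smooth hypersurfaces with supported middle cohomology -/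

namespace Literature.AlgebraicGeometry.Motives.IsSmoothHypersurface

open Literature.AlgebraicGeometry.Motives
open Literature.AlgebraicGeometry.HodgeTheory
open Literature.Barriers.HodgeConjecture (HasChowZeroSupportedInDimLE)

variable {m n e e' : ℕ} {Y Y' : SchemeOver ℂ}

/-- **`HC(Y × Y')` for two smooth hypersurfaces of ODD dimensions `m`, `n` whose middle cohomologies are
supported in codimensions `r`, `s` with `m + n ≤ 2(r + s + 1)`** (`Hᵐ(Y(ℂ); ℂ) = Nʳ Hᵐ`, `Hⁿ(Y'(ℂ); ℂ) = Nˢ Hⁿ`):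
off the middle degree both factors have algebraic even cohomology and no odd cohomology (Cor. 1.24–1.25), so
only the Künneth piece `Hᵐ(Y) ⊗ Hⁿ(Y')` matters (`BettiUniverse.hodgeConjectureFor_tensor_of_offMiddle_algebraic`),
and its Hodge classes are algebraic by §2. [cite: VoisinHodgeII2003, §1.2.3 Cor. 1.24 and Cor. 1.25]
[cite: VoisinHodgeI2002, §11.3.3 Thm. 11.38, Lemma 11.41 and p. 287] [cite: Voisin2013GHCBloch, Lemma 2.1 (proof)] -/
theorem hodgeConjectureFor_tensor_hypersurface_of_odd_of_odd_of_supportedClasses_eq_top [HodgeTensorFacts.{0, 0}]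
    (hY : IsSmoothHypersurface m e Y) (hY' : IsSmoothHypersurface n e' Y') (hHD : exists_isReal_hodgeModel)
    (hm : Odd m) (hn : Odd n) {r s : ℕ} (hrs : m + n ≤ 2 * (r + s + 1))
    (hYs : supportedClasses Y m r = ⊤) (hY's : supportedClasses Y' n s = ⊤) :
    HodgeConjectureFor (m + n) (Y ⊗ Y') := by
  refine BettiUniverse.hodgeConjectureFor_tensor_of_offMiddle_algebraic hHD hY.1 hY'.1 (hY.1.tensor_holds hY'.1)
    (hY.hodgeConjectureFor_of_odd hHD hm) (hY'.hodgeConjectureFor_of_odd hHD hn)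
    (fun _ hk hkm ↦ hY.finrank_bettiCohomology_eq_zero_of_odd hk hkm)
    (fun _ hp ↦ hY.hodgeClasses_hodge_eq_top_of_two_mul_ne hHD hY.1 hp)
    (fun _ hk hkn ↦ hY'.finrank_bettiCohomology_eq_zero_of_odd hk hkn)
    (fun _ hp ↦ hY'.hodgeClasses_hodge_eq_top_of_two_mul_ne hHD hY'.1 hp) fun c hmn t ht ↦ ?_
  -- `m + n = 2c` with `m`, `n` odd forces `c ≥ 1`; write `c = p + 1`
  have hc : 1 ≤ c := by
    rcases hm with ⟨a, ha⟩
    rcases hn with ⟨b, hb⟩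
    omega
  obtain ⟨p, rfl⟩ : ∃ p, c = p + 1 := ⟨c - 1, (Nat.sub_add_cancel hc).symm⟩
  have hp : p ≤ r + s := by omega
  exact BettiUniverse.ofRatClass_crossMap_mem_algebraicClasses_of_supportedClasses_eq_top hHD hY.1 hY'.1
    (hY.1.tensor_holds hY'.1) hmn hp hYs hY's ht

/-- Model-free form of the previous theorem (the standing tensor facts and the real Hodge model of the tree
are theorems: `hodgeTensorFacts_holds`, `exists_isReal_hodgeModel_holds`). [cite: VoisinHodgeII2003, §1.2.3 Cor. 1.24 and Cor. 1.25]
[cite: Voisin2013GHCBloch, Lemma 2.1 (proof)] -/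
theorem hodgeConjectureFor_tensor_hypersurface_of_odd_of_odd_of_supportedClasses_eq_top'
    (hY : IsSmoothHypersurface m e Y) (hY' : IsSmoothHypersurface n e' Y') (hm : Odd m) (hn : Odd n) {r s : ℕ}
    (hrs : m + n ≤ 2 * (r + s + 1)) (hYs : supportedClasses Y m r = ⊤) (hY's : supportedClasses Y' n s = ⊤) :
    HodgeConjectureFor (m + n) (Y ⊗ Y') := by
  haveI : HodgeTensorFacts.{0, 0} := hodgeTensorFacts_holds
  exact hY.hodgeConjectureFor_tensor_hypersurface_of_odd_of_odd_of_supportedClasses_eq_top hY' exists_isReal_hodgeModel_holds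
    hm hn hrs hYs hY's

/-! ### §4 `CH₀` of a smooth hypersurface of degree `≤ dim + 1` and the support of its middle cohomology -/

/-- **`CH₀` of a smooth complex hypersurface `n`-fold (`n ≥ 1`) of degree `1 ≤ e ≤ n + 1` is supported on a
closed algebraic subset of dimension `≤ n − 1`** (a hyperplane section; `HasChowZeroSupportedInDimLE Y (n - 1)`):
lines through every point for `e ≤ n` (`hasChowZeroSupportedInDimLE_of_isSmoothHypersurface`), Roitman's
strong lines in the boundary degree `e = n + 1` (`Motives.Hypersurface.exists_forall_isRationallyEquivalent_primeCycle_of_degree_le`,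
transported to `IsSmoothHypersurface` through its cutting-out closed immersion, the defining form being
irreducible hence prime). [cite: HirschowitzIyer2010, §1.3 and proof of Prop. 6.2 (i)] [cite: Roitman1980]
[cite: VoisinHodgeII2003, Prop. 10.26 and the remark following it (§10.2.3)] -/
theorem hasChowZeroSupportedInDimLE_of_degree_le_succ (hY : IsSmoothHypersurface n e Y) (hn : 1 ≤ n)
    (he : 0 < e) (hen : e ≤ n + 1) : HasChowZeroSupportedInDimLE Y (n - 1) := by
  rcases Nat.lt_or_ge e 2 with hlt | h2
  · have hen' : e ≤ n := by omega
    exact hasChowZeroSupportedInDimLE_of_isSmoothHypersurface hY he hen'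
  · obtain ⟨hsp, F, hF, hirr, -, i, hi, hV⟩ := hY
    haveI := hi
    haveI := hsp.smoothOfRelativeDimension
    haveI : Smooth Y.hom := SmoothOfRelativeDimension.smooth n _
    haveI : LocallyOfFiniteType Y.hom := inferInstance
    haveI : IsIntegral Y.left := Motives.IsSmoothProjective.isIntegral_holds hsp
    obtain ⟨W, hW, hWu, hpt⟩ :=
      Hypersurface.exists_forall_isRationallyEquivalent_primeCycle_of_degree_le (d := n) i
        ((MvPolynomial.mem_homogeneousSubmodule e F).2 hF)
        (UniqueFactorizationMonoid.irreducible_iff_prime.mp hirr) hV h2 hen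
    exact ⟨W, chowZeroSupportedInDimLE_of_forall_point hsp (by omega) hW hWu hpt⟩

/-- **The middle cohomology of a smooth hypersurface `n`-fold (`n ≥ 1`) of degree `1 ≤ e ≤ n + 1` is supported
on a divisor: `N¹ Hⁿ(Y(ℂ); ℂ) = Hⁿ(Y(ℂ); ℂ)`** — `CH₀(Y)` is supported in dimension `≤ n − 1 < n` (§4) and
Bloch–Srinivas' decomposition of the diagonal, PROVED on the tree's carriers
(`supportedClasses_eq_top_of_hasChowZeroSupportedInDimLE_of_lt`), gives `N¹ Hˡ = Hˡ` for every `l > n − 1`.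
[cite: BlochSrinivas1983, Thm. 1] [cite: VoisinHodgeII2003, §10.2.2 Thm. 10.17 and §10.3.1 Thm. 10.31] [cite: Voisin2025, §5.2 Thm. 5.6 and Cor. 5.7] -/
theorem supportedClasses_middle_one_eq_top_of_degree_le_succ (hY : IsSmoothHypersurface n e Y) (hn : 1 ≤ n)
    (he : 0 < e) (hen : e ≤ n + 1) : supportedClasses Y n 1 = ⊤ :=
  supportedClasses_eq_top_of_hasChowZeroSupportedInDimLE_of_lt hY.1
    (hY.hasChowZeroSupportedInDimLE_of_degree_le_succ hn he hen) (by omega)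

/-- **`H³` of a smooth hypersurface threefold of degree `≤ 4` in `ℙ⁴_ℂ` is supported on a divisor**:
`N¹ H³(Y(ℂ); ℂ) = H³(Y(ℂ); ℂ)` for `IsSmoothHypersurface 3 e Y`, `1 ≤ e ≤ 4` (cubic and quartic threefolds:
`h^{3,0} = 0` and `H³` is carried by the surface of lines / a hyperplane-section correspondence).
[cite: BlochSrinivas1983, Thm. 1] [cite: VoisinHodgeII2003, §10.3.1 Thm. 10.31] [cite: MurreTorino1994, §5.8.1] -/
theorem supportedClasses_three_one_eq_top_of_degree_le_four (hY : IsSmoothHypersurface 3 e Y) (he : 0 < e)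
    (he4 : e ≤ 4) : supportedClasses Y 3 1 = ⊤ :=
  hY.supportedClasses_middle_one_eq_top_of_degree_le_succ (by norm_num) he he4

/-! ### §5 `HC(Y × Y')` for smooth hypersurface threefolds of degree `≤ 4` -/

/-- **`HC(Y × Y')` for ANY two smooth hypersurface threefolds `Y, Y' ⊂ ℙ⁴_ℂ` of degrees `1 ≤ e, e' ≤ 4`** (planes,
quadrics, cubics, quartics in any combination), under the tree's standing tensor facts and a real Hodge model:
`H³ = N¹ H³` on both factors (§4) and §3 with `m = n = 3`, `r = s = 1`. [cite: BlochSrinivas1983, Thm. 1]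
[cite: Voisin2013GHCBloch, Lemma 2.1 (proof)] [cite: VoisinHodgeI2002, §11.3.3 Thm. 11.38, Lemma 11.41 and p. 287]
[cite: VoisinHodgeII2003, §1.2.3 Cor. 1.24–1.25 and §10.3.1 Thm. 10.31] -/
theorem hodgeConjectureFor_tensor_threefolds_of_degree_le_four_of_hodgeModel [HodgeTensorFacts.{0, 0}]
    (hY : IsSmoothHypersurface 3 e Y) (hY' : IsSmoothHypersurface 3 e' Y') (hHD : exists_isReal_hodgeModel)
    (he : 0 < e) (he4 : e ≤ 4) (he' : 0 < e') (he'4 : e' ≤ 4) : HodgeConjectureFor (3 + 3) (Y ⊗ Y') :=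
  hY.hodgeConjectureFor_tensor_hypersurface_of_odd_of_odd_of_supportedClasses_eq_top hY' hHD (by decide) (by decide)
    (r := 1) (s := 1) (by norm_num) (hY.supportedClasses_three_one_eq_top_of_degree_le_four he he4)
    (hY'.supportedClasses_three_one_eq_top_of_degree_le_four he' he'4)

/-- **`HC(Y × Y')` for ANY two smooth hypersurface threefolds `Y, Y' ⊂ ℙ⁴_ℂ of degrees `1 ≤ e, e' ≤ 4`,
UNCONDITIONALLY** (cubic × cubic, cubic × quartic, quartic × quartic, …): the instance hypothesis and the Hodge
model of the previous statement are theorems of the tree. [cite: BlochSrinivas1983, Thm. 1]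
[cite: Voisin2013GHCBloch, Lemma 2.1 (proof)] [cite: VoisinHodgeI2002, §11.3.3 Thm. 11.38, Lemma 11.41 and p. 287]
[cite: VoisinHodgeII2003, §1.2.3 Cor. 1.24–1.25 and §10.3.1 Thm. 10.31] -/
theorem hodgeConjectureFor_tensor_threefolds_of_degree_le_four (hY : IsSmoothHypersurface 3 e Y)
    (hY' : IsSmoothHypersurface 3 e' Y') (he : 0 < e) (he4 : e ≤ 4) (he' : 0 < e') (he'4 : e' ≤ 4) :
    HodgeConjectureFor (3 + 3) (Y ⊗ Y') := by
  haveI : HodgeTensorFacts.{0, 0} := hodgeTensorFacts_holds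
  exact hY.hodgeConjectureFor_tensor_threefolds_of_degree_le_four_of_hodgeModel hY' exists_isReal_hodgeModel_holds he he4 he' he'4

/-- **LEMMA AB (4;3,3) of the cell `hodge-nonav` (memo ROUTE-P3v20 §2–§3) on the tree's carrier**: the Hodge
conjecture holds for the product of any two smooth QUARTIC THREEFOLDS in `ℙ⁴_ℂ` — unconditionally.
[cite: BlochSrinivas1983, Thm. 1] [cite: Voisin2013GHCBloch, Lemma 2.1 (proof)]
[cite: VoisinHodgeI2002, §11.3.3 Thm. 11.38, Lemma 11.41 and p. 287] -/
theorem hodgeConjectureFor_tensor_quartic_threefolds (hY : IsSmoothHypersurface 3 4 Y)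
    (hY' : IsSmoothHypersurface 3 4 Y') : HodgeConjectureFor (3 + 3) (Y ⊗ Y') :=
  hY.hodgeConjectureFor_tensor_threefolds_of_degree_le_four hY' (by norm_num) le_rfl (by norm_num) le_rfl

/-- The cubic case for the record: **`HC(Y × Y')` for any two smooth cubic threefolds in `ℙ⁴_ℂ`** (their `H³(1)`
are the `H¹` of the intermediate Jacobians, principally polarised abelian fivefolds; the Hodge classes of
`H³(Y) ⊗ H³(Y')` — morphisms `JY' → JY` up to isogeny — are algebraic). [cite: BlochSrinivas1983, Thm. 1]
[cite: Voisin2013GHCBloch, Lemma 2.1 (proof)] [cite: MurreTorino1994, §5.8.1] -/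
theorem hodgeConjectureFor_tensor_cubic_threefolds (hY : IsSmoothHypersurface 3 3 Y)
    (hY' : IsSmoothHypersurface 3 3 Y') : HodgeConjectureFor (3 + 3) (Y ⊗ Y') :=
  hY.hodgeConjectureFor_tensor_threefolds_of_degree_le_four hY' (by norm_num) (by norm_num) (by norm_num) (by norm_num)

end Literature.AlgebraicGeometry.Motives.IsSmoothHypersurface

end
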